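import Summits.BirchSwinnertonDyer.BirchSwinnertonDyer.Theorems.UniversalToricDescentAcDualMuZeroCriterion
import Literature.NumberTheory.EllipticCurves.BDPAnticyclotomicPAdicLFunction
import Summits.BirchSwinnertonDyer.Rank1Residual.WAll.TargetAdditiveAtThreeCells
import Summits.BirchSwinnertonDyer.BirchSwinnertonDyer.Theorems.SchneiderFreeAdditiveX3Defs
import HarnessLib

/-!
# Route `CumulativeHeegnerLeopoldt`, crux K1 `CumulativeHeegnerInclusionAtThree` (stmt-BirchSwinnertonDyer-24198),
# line `birth` v3: the `μ`-HALF (former stub B `stub_charPrincipalMuZero`) FROM RESIDUAL-SELMER FINITENESS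
# (stub B1 `stub_residualSelmerFinite`) — HELPER (`--supports 24198`), lead prover bsd-line-chl-k1-p1 g0

Line `birth` composes K1 (span{L} ⊆ Ch_Λ(X_{∅,0})·R₀⟦T⟧ on the Leopoldt cell) from stub A (tempered inclusion),
stub B (Ch·R₀⟦T⟧ principal with a norm-one coefficient, i.e. `μ_alg = 0`) and stub C (saturation at `3`, landed
p595383). This file certifies, with NO new definition, NO named fact and NO `sorry`, that stub B is NOT research:

* §1 `isTorsion_and_charPrincipalMuZero_of_residualFinite` — for ANY elliptic `W/ℚ`, number field `K`,
  `ℤ₃`-extension `κ` with topological generator `γ` and prime `𝔭′` of `K`: if the `3`-torsion of Castella's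
  anticyclotomic Selmer group `Sel_{𝔭′}(K_∞, E[3^∞])` (`AcSelmer.selmerAc (W.baseChange K) 3 κ 𝔭′ ∅`, strict at
  `𝔭′`, relaxed at the other primes above `3`, `Σ = ∅`) is finite, then the constructed dual
  `X = AcSelmer.XAc (W.baseChange K) 3 κ 𝔭′ ∅ γ` is `Λ`-torsion and `Ch_Λ(X)·R₀⟦T⟧ = (g)` for some `g ∈ R₀⟦T⟧` with a
  coefficient of norm `1` — Greenberg's criterion (Sel[p] finite ⟹ X torsion, μ = 0, X f.g. over ℤ_p) read
  in the route's `R₀⟦T⟧`-currency; this is route UTD's landed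
  `UniversalToricDescentAcDualMuZero.isTorsion_and_exists_generator_of_finite_pTorsion` (utd-p1 g6) at
  `(p, Σ) = (3, ∅)` on the base change, cited, not re-proved.
* §2 `stub_charPrincipalMuZero_of_stub_residualSelmerFinite` — the registered signature of the former stub B
  VERBATIM, from the registered signature of stub B1 VERBATIM displayed as a hypothesis (kernel identity of the
  v3 reshape, skeleton sha16 f4498654b697668f): after this file the open content of the `μ`-half of K1 is EXACTLY
  B1 = «`Sel_{𝔭′}(K_∞, E[3^∞])[3]` finite on the cell», which is Castella–Grossi–Lee–Skinner, Invent. Math. 227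
  (2022) §3 (arXiv:2008.02571 §1, Prop. «propmodp»: `H¹_{F_Gr}(K, M_E[p]) ≅ H¹_{F_Gr}(K, M_E)[p]` finite, from
  the two characters `φ, ψ = ωφ⁻¹` of `E[p]^ss` via Rubin–Hida `μ = 0`, under `φ|G_p ∉ {1, ω}` = the cell's
  non-anomalous clause) with their standing «good reduction at p» (§1.3) replaced by wild additive reduction
  at `3` — a transfer the §1 Galois-cohomology arguments appear to allow (they use `p > 2` split in `K`,
  `E(K_w)[p] = 0` for `w ∣ p`, and that the conductors of `φ, ψ` are divisible only by primes split in `K`),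
  but which is NOT in print; hence B1 stays a stub.

HONEST STATUS: K1 is NOT closed (stub A, the rational BDP divisibility at additive `3`, is beyond print); nothing
here is progress on A; BSD is not proved for any curve by any of this. Supports, does not close,
stmt-BirchSwinnertonDyer-24198.

References: [GreenbergLNM1716] §1 p. 60; [GreenbergVatsal2000] Prop. (2.8); [CastellaGrossiLeeSkinner2022] §3
(arXiv:2008.02571 §1, Prop. propmodp, Thm. Rubin–Hida); [Castella2018] §2.1–2.2 (the Selmer group and `Λ`).
-/

set_option autoImplicit false
set_option linter.dupNamespace false -- `Summit.BirchSwinnertonDyer.BirchSwinnertonDyer.Theorems.…` (summit = sub)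

noncomputable section

open scoped Classical

namespace Summit.BirchSwinnertonDyer.BirchSwinnertonDyer.Theorems.CumulativeHeegnerInclusionAtThreeMuHalf

open PowerSeries NumberField IsDedekindDomain Field
  Literature.NumberTheory.EllipticCurves Literature.NumberTheory.GaloisRepresentations
  Summit.BirchSwinnertonDyer.Rank1Residual.X11b Summit.BirchSwinnertonDyer.Rank1Residual.X11b.AcSelmer
  Summit.BirchSwinnertonDyer.BirchSwinnertonDyer.Theorems.UniversalToricDescentAcDualMuZero

/-! ### §1 Greenberg's criterion at `(3, ∅)` on the base change -/

/-- **Residual finiteness ⟹ torsion and `μ_alg = 0` in `R₀⟦T⟧`-currency.** For an elliptic curve `W/ℚ`, a number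
field `K`, a `ℤ₃`-extension `κ` of `K` with topological generator `γ` and a prime `𝔭′` of `K`: if
`Sel_{𝔭′}(K_∞, E[3^∞])[3]` is finite then `X = X_ac(E[3^∞])` (strict at `𝔭′`, `Σ = ∅`) is `Λ`-torsion and
`Ch_Λ(X)·R₀⟦T⟧ = (g)` with `‖g_n‖ = 1` for some `n` (Greenberg's criterion, route UTD's
`isTorsion_and_exists_generator_of_finite_pTorsion` at `p = 3`, `Σ = ∅`). [cite: GreenbergLNM1716, §1 p. 60] -/
theorem isTorsion_and_charPrincipalMuZero_of_residualFinite (W : WeierstrassCurve ℚ) [W.IsElliptic]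
    (K : Type) [Field K] [NumberField K] (κ : ZpExtension K 3) (γ : absoluteGaloisGroup K)
    [Fact (κ.IsTopGenerator γ)] (𝔭' : HeightOneSpectrum (𝓞 K))
    (hfin : Set.Finite {s : selmerAc (W.baseChange K) 3 κ 𝔭' ∅ | (3 : ℕ) • s = 0}) :
    Module.IsTorsion (IwasawaAlgebra 3) (XAc (W.baseChange K) 3 κ 𝔭' ∅ γ) ∧
      ∃ (g : UnrSeries 3) (n : ℕ),
        (XAc.charIdeal (W.baseChange K) 3 κ 𝔭' ∅ γ).map (PowerSeries.map (Halves.toUnr 3)) = Ideal.span {g} ∧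
          ‖((PowerSeries.coeff n g : unrIntegers 3) : ℂ_[3])‖ = 1 := by
  haveI : (W.baseChange K).IsElliptic := inferInstanceAs (W.map (algebraMap ℚ K)).IsElliptic
  obtain ⟨hT, g, hg, n, hn⟩ :=
    isTorsion_and_exists_generator_of_finite_pTorsion (W.baseChange K) 3 κ 𝔭' ∅ γ Set.finite_empty hfin
  exact ⟨hT, g, n, hg, hn⟩

/-! ### §2 The kernel identity of the v3 reshape: former stub B from stub B1 -/

/-- **Former stub B `stub_charPrincipalMuZero` of line `birth` (signature VERBATIM) from stub B1
`stub_residualSelmerFinite` (signature VERBATIM, displayed as the hypothesis `hB1`).** On the Leopoldt cell at every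
frame, `Ch_Λ(X_{∅,0})·R₀⟦T⟧` is principal with a generator having a norm-one coefficient, granted residual-Selmer
finiteness on the cell; the frame binders (`Dt, γ, 𝔭, ι′, Ω_K, Ω_p, L`, the BDP property, `r_an = 1`) are idle
for the `μ`-half. Nothing is asserted about B1. [cite: CastellaGrossiLeeSkinner2022, §3 Prop. 3.2.1 (arXiv:2008.02571 §1 Prop. propmodp) (shape of B1 only; nothing asserted)] -/
theorem stub_charPrincipalMuZero_of_stub_residualSelmerFinite
    (hB1 : ∀ (W : WeierstrassCurve ℚ) [W.IsElliptic] [W.IsGloballyMinimal] (N : ℕ) [NeZero N] (K : Type) [Field K] [NumberField K], Summit.BirchSwinnertonDyer.Rank1Residual.Additive.ClassO6 W 3 → Literature.NumberTheory.EllipticCurves.Rank1Residual.Red W 3 → (∃ Φ : AddSubgroup (WeierstrassCurve.geomTorsion W ((3 : ℕ) : ℤ)), Literature.NumberTheory.EllipticCurves.Rank1Residual.IsRationalLine W 3 Φ ∧ ∀ (v : IsDedekindDomain.HeightOneSpectrum (NumberField.RingOfIntegers ℚ)), ((3 : ℕ) : NumberField.RingOfIntegers ℚ) ∈ v.asIdeal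 → ∀ 𝔓 ∈ v.primesAbove, ¬ (∀ g ∈ 𝔓.decompositionSubgroup (Field.absoluteGaloisGroup ℚ), ∀ P ∈ Φ, g • P = P) ∧ ¬ (∀ g ∈ 𝔓.decompositionSubgroup (Field.absoluteGaloisGroup ℚ), ∀ P : WeierstrassCurve.geomTorsion W ((3 : ℕ) : ℤ), g • P - P ∈ Φ)) → W.conductorNorm ℤ = N → Literature.NumberTheory.EllipticCurves.IsImaginaryQuadratic K → Literature.NumberTheory.EllipticCurves.SatisfiesHeegnerHypothesis N K → ∀ (κ : Literature.NumberTheory.EllipticCurves.ZpExtension K 3), κ.IsAnticyclotomic → ∀ (𝔭' : IsDedekindDomain.HeightOneSpectrum (NumberField.RingOfIntegers K)), ((3 : ℕ) : NumberField.RingOfIntegers K) ∈ 𝔭'.asIdeal → Set.Finite {s : Summit.BirchSwinnertonDyer.Rank1Residual.X11b.AcSelmer.selmerAc (W.baseChange K) 3 κ 𝔭' ∅ | (3 : ℕ) • s = 0}) :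
    ∀ (W : WeierstrassCurve ℚ) [W.IsElliptic] [W.IsGloballyMinimal] (N : ℕ) [NeZero N] (K : Type) [Field K] [NumberField K] (Dt : Literature.NumberTheory.EllipticCurves.ModularForms.ModularParametrizationData W N), Summit.BirchSwinnertonDyer.Rank1Residual.Additive.ClassO6 W 3 → Literature.NumberTheory.EllipticCurves.Rank1Residual.Red W 3 → (∃ Φ : AddSubgroup (WeierstrassCurve.geomTorsion W ((3 : ℕ) : ℤ)), Literature.NumberTheory.EllipticCurves.Rank1Residual.IsRationalLine W 3 Φ ∧ ∀ (v : IsDedekindDomain.HeightOneSpectrum (NumberField.RingOfIntegers ℚ)), ((3 : ℕ) : NumberField.RingOfIntegers ℚ) ∈ v.asIdeal → ∀ 𝔓 ∈ v.primesAbove, ¬ (∀ g ∈ 𝔓.decompositionSubgroup (Field.absoluteGaloisGroup ℚ), ∀ P ∈ Φ, g • P = P) ∧ ¬ (∀ g ∈ 𝔓.decompositionSubgroup (Field.absoluteGaloisGroup ℚ), ∀ P : WeierstrassCurve.geomTorsion W ((3 : ℕ) : ℤ), g • P - P ∈ Φ)) → W.analyticRank = 1 → W.conductorNorm ℤ = N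 → Literature.NumberTheory.EllipticCurves.IsImaginaryQuadratic K → Literature.NumberTheory.EllipticCurves.SatisfiesHeegnerHypothesis N K → ∀ (κ : Literature.NumberTheory.EllipticCurves.ZpExtension K 3), κ.IsAnticyclotomic → ∀ (γ : Field.absoluteGaloisGroup K) [Fact (κ.IsTopGenerator γ)] (𝔭 : IsDedekindDomain.HeightOneSpectrum (NumberField.RingOfIntegers K)), ((3 : ℕ) : NumberField.RingOfIntegers K) ∈ 𝔭.asIdeal → 𝔭.asIdeal.ramificationIdx (NumberField.RingOfIntegers ℚ) = 1 → 𝔭.asIdeal.inertiaDeg (NumberField.RingOfIntegers ℚ) = 1 → ∀ (𝔭' : IsDedekindDomain.HeightOneSpectrum (NumberField.RingOfIntegers K)), ((3 : ℕ) : NumberField.RingOfIntegers K) ∈ 𝔭'.asIdeal → 𝔭' ≠ 𝔭 → ∀ (ι' : PadicAlgCl 3 ≃+* ℂ), Summit.BirchSwinnertonDyer.BirchSwinnertonDyer.Theorems.SchneiderFree.BranchInducesPrime 3 ι' 𝔭 → ∀ (ΩK : ℂ) (Ωp : ℂ_[3]) (L : Literature.NumberTheory.EllipticCurves.UnrSeries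 3), ΩK ≠ 0 → Ωp ≠ 0 → Literature.NumberTheory.EllipticCurves.IsBDPLFunction ι' 𝔭 κ γ Dt.f ΩK Ωp L → ∃ (g : Literature.NumberTheory.EllipticCurves.UnrSeries 3) (n : ℕ), (Summit.BirchSwinnertonDyer.Rank1Residual.X11b.AcSelmer.XAc.charIdeal (W.baseChange K) 3 κ 𝔭' ∅ γ).map (PowerSeries.map (Summit.BirchSwinnertonDyer.Rank1Residual.X11b.Halves.toUnr 3)) = Ideal.span {g} ∧ ‖((PowerSeries.coeff n g : Literature.NumberTheory.EllipticCurves.unrIntegers 3) : ℂ_[3])‖ = 1 := by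
  intro W _ _ N _ K _ _ _Dt hO6 hRed hcell _hr hN hK hHg κ hκ γ _ 𝔭 _h𝔭 _he _hf 𝔭' h𝔭' _hne _ι' _hι _ΩK _Ωp _L
    _hΩK _hΩp _hBDP
  exact (isTorsion_and_charPrincipalMuZero_of_residualFinite W K κ γ 𝔭'
    (hB1 W N K hO6 hRed hcell hN hK hHg κ hκ 𝔭' h𝔭')).2

end Summit.BirchSwinnertonDyer.BirchSwinnertonDyer.Theorems.CumulativeHeegnerInclusionAtThreeMuHalf

end
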